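import Mathlib.AlgebraicGeometry.Morphisms.Smooth
import Mathlib.AlgebraicGeometry.Morphisms.FiniteType
import Mathlib.Topology.KrullDimension
import Literature.AlgebraicGeometry.Motives.Varieties
import Literature.AlgebraicGeometry.Motives.AlgPoints
import HarnessLib

/-!
# Two points of an irreducible variety lie on an irreducible curve (Mumford), normalised smooth affine form

Topic `Literature/AlgebraicGeometry/Motives` (family `hodge`). The classical lemma of Mumford,
*Abelian Varieties* (1970), §6, Lemma: "Any two points of an irreducible variety `X` lie on an
irreducible curve `C` on `X`" (proof: blow up the two points and cut the blow-up, embedded in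
projective space, by general hyperplanes — Bertini's theorem keeps the sections irreducible of
dimension one less — until a curve remains), recorded as the NAMED FACT
`mumford_smoothCurve_through_two_points` in the normalised form in which base-change arguments consume
it on the tree's real carriers (`SchemeOver ℂ`, complex points `ComplexPoints`, `AlgPoints.map`,
`AlgPoints.pt`):

* for an AFFINE `ℂ`-scheme `S` locally of finite type, a closed irreducible subset `Z ⊆ S` and two
  DISTINCT complex points `a ≠ b` of `S` lying on `Z`, there are a smooth irreducible affine
  `ℂ`-scheme `C` of topological Krull dimension `1` (a smooth irreducible affine curve), a
  `ℂ`-morphism `g : C ⟶ S` with image inside `Z`, and complex points `a'`, `b'` of `C` over `a`, `b`.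

Derivation from print. Give `Z` its reduced structure: an irreducible affine variety over `ℂ`, of
dimension `≥ 1` since it carries the two distinct closed points `pt a ≠ pt b` (complex points of a
`ℂ`-scheme locally of finite type are determined by their closed points, the residue fields being
`ℂ`). By Mumford's lemma `pt a`, `pt b` lie on an irreducible closed curve `D ⊆ Z`. Its
normalisation `ν : C = D^ν → D` is finite and surjective (Liu, *Algebraic Geometry and Arithmetic
Curves*, Cor. 4.1.30), so `C` is affine with `D`, integral, of dimension `1` (finite morphisms
preserve dimension, Liu Prop. 2.5.10), normal hence regular (Liu Ex. 4.2.9) hence smooth over the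
perfect field `ℂ` (Liu Cor. 4.3.33); closed points of `C` over `pt a`, `pt b` have residue field
`ℂ` and give complex points `a'`, `b'` with `g a' = a`, `g b' = b` for `g : C → D → Z → S`.

The one-point companion — through a closed point of a variety passes an integral curve avoiding a
given proper closed subset — is PROVED in the tree (`Motives/CurveThroughPoint`, prime avoidance);
the two-point lemma needs Bertini's irreducibility theorem, which Mathlib does not have, so it is a
named fact here. Consumers: the reduction of Grothendieck's variational Hodge conjecture to curve
bases (`Summits/HodgeConjecture/…/AnchorTransportVariationalHodgeCurveBase`), and the curve input
(A0) of André's deformation theorem (`HodgeTheory/MotivatedClassesDeformationInputs`,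
`Andre1996_deformation_of_affine_curves`, which in addition wants the curve quasi-projective).

* `mumford_smoothCurve_through_two_points.of_irreducibleSpace` — the case `Z = S` of an irreducible
  affine `S` (unfolding only).

## What is NOT here

* The general printed form (any irreducible variety over an algebraically closed field, conclusion
  an irreducible closed curve `D ⊆ X` through the points, not normalised) — only the affine complex
  case is stated. -- TODO(general form): Mumford's lemma verbatim over an algebraically closed field.
* Quasi-projectivity of the curve `C` (true: affine of finite type), not recorded.

## References

* [MumfordAV1970] D. Mumford, Abelian Varieties, TIFR Studies in Math. 5, OUP 1970, §6, Lemma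
  ("Any two points of an irreducible variety lie on an irreducible curve").
* [Liu2002] Q. Liu, Algebraic Geometry and Arithmetic Curves, OUP 2002, Prop. 2.5.10, Cor. 4.1.30,
  Ex. 4.2.9, Cor. 4.3.33.
-/

noncomputable section

open CategoryTheory AlgebraicGeometry

namespace Literature.AlgebraicGeometry.Motives

/-- **Any two points of an irreducible variety lie on an irreducible curve** (Mumford, *Abelian
Varieties*, §6, Lemma), normalised smooth affine form over `ℂ`: for an affine `ℂ`-scheme `S` locally
of finite type, a closed irreducible subset `Z ⊆ S`, and two DISTINCT complex points `a ≠ b` of `S`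
on `Z` (so that the affine variety `Z_red` has dimension `≥ 1`), there are a smooth irreducible AFFINE
`ℂ`-scheme `C` of topological Krull dimension `1` — a smooth irreducible affine curve: the
normalisation of an irreducible curve `D ⊆ Z_red` through `pt a`, `pt b` given by Mumford's lemma,
finite over `D` (Liu Cor. 4.1.30), of dimension `1` (Liu Prop. 2.5.10), regular (Liu Ex. 4.2.9) hence
smooth over `ℂ` (Liu Cor. 4.3.33) — a `ℂ`-morphism `g : C ⟶ S` whose image lies in `Z`, and complex
points `a'`, `b'` of `C` with `g a' = a` and `g b' = b` (closed points of `C` over `pt a`, `pt b` have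
residue field `ℂ`). Special case (affine, over `ℂ`, normalised) of the printed lemma.
[cite: MumfordAV1970, §6, Lemma (any two points of an irreducible variety lie on an irreducible curve)]
[cite: Liu2002, Prop. 2.5.10, Cor. 4.1.30, Ex. 4.2.9, Cor. 4.3.33 (normalisation of a curve: finite, dimension 1, regular, smooth)] -/
def mumford_smoothCurve_through_two_points : Prop :=
  ∀ ⦃S : SchemeOver ℂ⦄, IsAffine S.left → LocallyOfFiniteType S.hom →
    ∀ (Z : Set S.left), IsClosed Z → IsIrreducible Z →
    ∀ (a b : ComplexPoints S), a.pt ∈ Z → b.pt ∈ Z → a ≠ b →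
      ∃ (C : SchemeOver ℂ) (g : C ⟶ S) (a' b' : ComplexPoints C),
        IsAffine C.left ∧ IrreducibleSpace C.left ∧ AlgebraicGeometry.Smooth C.hom ∧
          topologicalKrullDim C.left = 1 ∧ (∀ c : C.left, g.left.base c ∈ Z) ∧
          AlgPoints.map g a' = a ∧ AlgPoints.map g b' = b

/-- **The case `Z = S`**: granted the fact, two distinct complex points of an IRREDUCIBLE affine
`ℂ`-scheme locally of finite type lie in the image of a smooth irreducible affine curve (unfolding of
`mumford_smoothCurve_through_two_points` with `Z = Set.univ`). [cite: MumfordAV1970, §6, Lemma] -/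
theorem mumford_smoothCurve_through_two_points.of_irreducibleSpace
    (h : mumford_smoothCurve_through_two_points) {S : SchemeOver ℂ} [IsAffine S.left]
    [LocallyOfFiniteType S.hom] [IrreducibleSpace S.left] (a b : ComplexPoints S) (hab : a ≠ b) :
    ∃ (C : SchemeOver ℂ) (g : C ⟶ S) (a' b' : ComplexPoints C),
      IsAffine C.left ∧ IrreducibleSpace C.left ∧ AlgebraicGeometry.Smooth C.hom ∧
        topologicalKrullDim C.left = 1 ∧ AlgPoints.map g a' = a ∧ AlgPoints.map g b' = b := by
  obtain ⟨C, g, a', b', hC, hirr, hsm, hdim, -, ha, hb⟩ :=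
    h ‹_› ‹_› Set.univ isClosed_univ (IrreducibleSpace.isIrreducible_univ S.left) a b
      (Set.mem_univ _) (Set.mem_univ _) hab
  exact ⟨C, g, a', b', hC, hirr, hsm, hdim, ha, hb⟩

end Literature.AlgebraicGeometry.Motives

end
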